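import Summits.NavierStokesRegularity.NavierStokesRegularity.Theses.SymmetryModuliCount
import Summits.NavierStokesRegularity.NavierStokesRegularity.Theorems.TypeICertificateLadderTargetTypeIZoomCompactness
import Summits.NavierStokesRegularity.NavierStokesRegularity.Theorems.SqueezeCycleExtremalElementExistsRegularity
import Literature.Analysis.FluidPDE.KNSSTypeIIHolds
import Literature.Analysis.FluidPDE.KNSSTypeIIZoomIn
import Literature.Analysis.FluidPDE.KNSSTypeIRateMildProofs
import Literature.Analysis.FluidPDE.KNSSTypeIRateMildBridge
import Literature.Analysis.FluidPDE.TaoLocalisationHolds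
import Literature.Analysis.FluidPDE.TaoLocalisationProofs
import Literature.Analysis.FluidPDE.LerayHopfRestartEverywhere
import Literature.Analysis.FluidPDE.LerayHopfMild
import Literature.Analysis.FluidPDE.LerayHopfProofs
import Literature.Analysis.FluidPDE.NSLerayOseenRepresentation
import Literature.Analysis.FluidPDE.OseenMildHolder
import Literature.Analysis.FluidPDE.NSViscosityRescaling
import HarnessLib

/-!
# Route `SymmetryModuliCount`, support item `LiouvilleKillsTypeI` (stmt-NavierStokesRegularity-4056)

The KNOWN glue of the assembly: the Liouville statement (L') in the KNSS Oseen gauge ("every smooth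
divergence-free KNSS-mild ancient field with `‖u(t,x)‖ ≤ C/√(−t)` vanishes") excludes Type-I
blow-up of finite-energy classical solutions from rapidly decaying data (Koch–Nadirashvili–
Seregin–Šverák 2009, §6: Prop. 6.1, Lemma 6.1, proof of Thm. 6.2; Seregin–Šverák 2009, §4;
Albritton–Barker 2019, §3). All analytic inputs are theorems of the tree: bounds on closed
sub-slabs (Tao 2013, `tao2011_hasBoundedSobolevNormsOn_holds`, Sobolev imbedding), whence the Type-I
rate on the whole interval; the Oseen integral equation restarted at every positive time (Leray–Hopf
restart, Fabes–Jones–Rivière, `ae_eq_heatExtension_sub_oseenDuhamel_of_isMildNSSolutionOn`); the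
zoom at near-maxima (`exists_near_max`, `oseen_smul_stPull`), Type-I zoom compactness
(`typeIZoom_compactness`, KNSS Lemma 6.1), membership of the limit in `IsTypeIAncientMild C`
(`isTypeIAncientMild_of_continuous_oseenMild`), the vertex via the uniform Hölder modulus
(`exists_holder_quarter_of_oseenMild`); viscosity normalisation (`oseenDuhamel_one_timeRescale`) and
continuation of bounded classical Leray–Hopf solutions (`hasSmoothExtensionPast_of_bounded_holds`).
-/

noncomputable section

namespace Summit.NavierStokesRegularity.NavierStokesRegularity.Theorems

open MeasureTheory Set Function Filter Topology TopologicalSpace Metric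
open scoped NNReal ENNReal
open Literature.Analysis Literature.Analysis.FluidPDE

/-- **Bounds on closed sub-slabs.** A classical solution of the unforced Navier–Stokes system
(`ν > 0`) on `ℝ³ × [0, T)`, Leray–Hopf from its rapidly decaying datum, is bounded on
`[0, T'] × ℝ³` for every `0 < T' < T` (Tao 2013, Cor. 11.1 + Cor. 4.3 + Thm. 5.4 (iv):
`tao2011_hasBoundedSobolevNormsOn_holds`; Sobolev imbedding `H² ⊂ C_B`:
`linfty_bound_of_hasBoundedSobolevNormsOn_holds`). [cite: Tao2011, Cor. 11.1 + Cor. 4.3 + Thm. 5.4 (iv)] -/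
theorem liouvilleKillsTypeI_exists_bound_Icc {ν T : ℝ} (hν : 0 < ν)
    {u : ℝ → EuclideanSpace ℝ (Fin 3) → EuclideanSpace ℝ (Fin 3)}
    {p : ℝ → EuclideanSpace ℝ (Fin 3) → ℝ} (hcl : IsClassicalNSSolutionOn (Ico 0 T) ν 0 u p)
    (hLH : IsLerayHopfOn T ν 0 (u 0) u) (hdec : HasRapidSpatialDecay (u 0)) {T' : ℝ}
    (hT' : T' ∈ Ioo 0 T) : ∃ M : ℝ, ∀ t ∈ Icc 0 T', ∀ x, ‖u t x‖ ≤ M := by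
  have hsol' : IsClassicalNSSolutionOn (Icc 0 T') ν 0 u p :=
    hcl.mono (Icc_subset_Ico_right hT'.2) (uniqueDiffOn_Icc hT'.1)
  have hE : ∃ C : ℝ≥0∞, C < ⊤ ∧ ∀ t ∈ Icc 0 T', ∫⁻ x, ‖u t x‖ₑ ^ 2 ≤ C :=
    ⟨ENNReal.ofReal (2 * VectorCalculus.kineticEnergy (u 0)), ENNReal.ofReal_lt_top, fun t ht =>
      hLH.lintegral_enorm_sq_le hν.le ⟨ht.1, ht.2.trans hT'.2.le⟩⟩
  have hH := (tao2011_hasBoundedSobolevNormsOn.closedSlab tao2011_hasBoundedSobolevNormsOn_holds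
    linfty_bound_of_hasBoundedSobolevNormsOn_holds ν T' hν hT'.1 u p hsol' hE hdec).1
  exact linfty_bound_of_hasBoundedSobolevNormsOn_holds
    (fun t ht => (hsol'.contDiff_velocity ht).of_le (by norm_cast)) hH

/-- **Mildness in the Oseen gauge, restarted at every positive time**: for a classical solution
(`ν > 0`) on `ℝ³ × [0, T)`, Leray–Hopf from `u 0`, bounded on every closed sub-slab, and
`0 < s < t < T`, `u(t, x) = (e^{ν(t−s)Δ}u(s))(x) − B^ν_s(u, u)(t)(x)` pointwise: the translate
`u(· + s)` is Leray–Hopf from `u(s)`, hence duality-mild (Fabes–Jones–Rivière 1972), hence an Oseen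
solution a.e. (Lemarié-Rieusset 2016, Thm. 6.1); both sides are continuous. [cite: KochNadirashviliSereginSverak2009, §4 p. 8 (arXiv:0709.3599): u = U + B(u,u) restarted at every time] -/
theorem liouvilleKillsTypeI_oseen_identity {ν T : ℝ} (hν : 0 < ν) (hT : 0 < T)
    {u : ℝ → EuclideanSpace ℝ (Fin 3) → EuclideanSpace ℝ (Fin 3)}
    {p : ℝ → EuclideanSpace ℝ (Fin 3) → ℝ} (hcl : IsClassicalNSSolutionOn (Ico 0 T) ν 0 u p)
    (hLH : IsLerayHopfOn T ν 0 (u 0) u)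
    (hbdd : ∀ T' ∈ Ioo 0 T, ∃ M : ℝ, ∀ t ∈ Icc 0 T', ∀ x, ‖u t x‖ ≤ M)
    {s t : ℝ} (hs : 0 < s) (hst : s < t) (htT : t < T) (x : EuclideanSpace ℝ (Fin 3)) :
    u t x = UnboundedOperators.heatExtension (u s) (ν * (t - s)) x - oseenDuhamel ν s u u t x := by
  obtain ⟨T₁, hT₁, htT₁⟩ : ∃ T₁ ∈ Ioo 0 T, t < T₁ :=
    ⟨(t + T) / 2, ⟨by linarith, by linarith⟩, by linarith⟩
  obtain ⟨M₀, hM₀⟩ := hbdd T₁ hT₁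
  have hM : (0 : ℝ) < max M₀ 1 := lt_of_lt_of_le one_pos (le_max_right _ _)
  have hMb : ∀ τ ∈ Icc 0 T₁, ∀ y, ‖u τ y‖ ≤ max M₀ 1 := fun τ hτ y =>
    (hM₀ τ hτ y).trans (le_max_left _ _)
  have hLH₁ : IsLerayHopfOn T₁ ν 0 (u 0) u := hLH.of_le hT₁.2.le
  have hcl₁ : IsClassicalNSSolutionOn (Ico 0 T₁) ν 0 u p :=
    hcl.mono (Ico_subset_Ico_right hT₁.2.le) (uniqueDiffOn_Ico 0 T₁)
  have hu₀ : MemLp (u 0) 2 volume := hLH.memLp 0 ⟨le_rfl, hT.le⟩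
  have hsI : s ∈ Ioo 0 T₁ := ⟨hs, hst.trans htT₁⟩
  have hsT : s < T := hsI.2.trans hT₁.2
  have hsIco : s ∈ Ico 0 T := ⟨hs.le, hsT⟩
  have hLHs : IsLerayHopfOn (T₁ - s) ν 0 (u s) (fun r => u (r + s)) :=
    hLH₁.isLerayHopfOn_translate_of_bound hν hT₁.1 hu₀ hcl₁ hMb hsI
  have hTs : 0 < T₁ - s := sub_pos.2 hsI.2
  have hus2 : MemLp (u s) 2 volume := hLH.memLp s ⟨hs.le, hsT.le⟩
  have hm0 : IsMildNSSolutionOn (Ioc 0 (T₁ - s)) ν 0 (u s) (fun r => u (r + s)) :=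
    hLHs.isMildNSSolutionOn_Ioc finrank_euclideanSpace_fin hus2 hν hTs
  have hmild : IsMildNSSolutionOn (Ioc 0 (T₁ - s)) ν 0 ((fun r : ℝ => u (r + s)) 0)
      (fun r => u (r + s)) := by
    simpa only [zero_add] using hm0
  have hcont : ContinuousOn (uncurry u) (Ico 0 T ×ˢ univ) := hcl.smooth_velocity.continuousOn
  have hvmeas : AEStronglyMeasurable (uncurry fun r => u (r + s))
      ((volume : Measure (ℝ × EuclideanSpace ℝ (Fin 3))).restrict (Ioo 0 (T₁ - s) ×ˢ univ)) := by
    have e : (uncurry fun r => u (r + s)) =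
        uncurry u ∘ fun q : ℝ × EuclideanSpace ℝ (Fin 3) => (q.1 + s, q.2) := by
      funext q; rfl
    rw [e]
    refine (hcont.comp ((continuous_fst.add continuous_const).prodMk continuous_snd).continuousOn
      ?_).aestronglyMeasurable (measurableSet_Ioo.prod MeasurableSet.univ)
    intro q hq
    obtain ⟨⟨hq1, hq2⟩, -⟩ := hq
    refine ⟨⟨?_, ?_⟩, mem_univ _⟩
    · show (0 : ℝ) ≤ q.1 + s
      linarith
    · show q.1 + s < T
      linarith [hT₁.2]
  have hmemI : ∀ r ∈ Icc 0 (T₁ - s), r + s ∈ Ico 0 T := fun r hr =>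
    ⟨by linarith [hr.1], by linarith [hr.2, hT₁.2]⟩
  have hvsl : ∀ r ∈ Icc 0 (T₁ - s), AEStronglyMeasurable ((fun r => u (r + s)) r) volume :=
    fun r hr => (hcl.contDiff_velocity (hmemI r hr)).continuous.aestronglyMeasurable
  have hvbd : ∀ r ∈ Icc 0 (T₁ - s), ∀ y, ‖(fun r => u (r + s)) r y‖ ≤ max M₀ 1 := fun r hr y =>
    hMb (r + s) ⟨by linarith [hr.1], by linarith [hr.2]⟩ y
  have hdivs : IsWeaklyDivFree (u s) :=
    VectorCalculus.IsDivFree.isWeaklyDivFree_holds (hcl.divFree s hsIco)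
      (contDiff_infty.1 (hcl.contDiff_velocity hsIco) 1)
  have hvdiv : IsWeaklyDivFree ((fun r : ℝ => u (r + s)) 0) := by
    simpa only [zero_add] using hdivs
  have hv2 : ∀ r ∈ Icc 0 (T₁ - s), MemLp ((fun r => u (r + s)) r) 2 volume := fun r hr =>
    hLH.memLp (r + s) ⟨by linarith [hr.1], by linarith [hr.2, hT₁.2]⟩
  have hae := ae_eq_heatExtension_sub_oseenDuhamel_of_isMildNSSolutionOn hν hTs hmild hvmeas hvsl
    hM hvbd hvdiv hv2 (t := t - s) ⟨sub_pos.2 hst, by linarith⟩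
  have htr : ∀ y, oseenDuhamel ν 0 (fun r => u (r + s)) (fun r => u (r + s)) (t - s) y =
      oseenDuhamel ν s u u t y := fun y => by
    rw [oseenDuhamel_translate, zero_add, sub_add_cancel]
  simp only [sub_add_cancel, zero_add] at hae
  simp_rw [htr] at hae
  have hum : AEStronglyMeasurable (uncurry u)
      ((volume : Measure (ℝ × EuclideanSpace ℝ (Fin 3))).restrict (Ioo s T₁ ×ˢ univ)) :=
    (hcont.mono (prod_mono (fun τ hτ => ⟨hs.le.trans hτ.1.le, hτ.2.trans hT₁.2⟩)
      subset_rfl)).aestronglyMeasurable (measurableSet_Ioo.prod MeasurableSet.univ)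
  have hBτ : ∀ τ ∈ Ioo s T₁, ∀ y, ‖u τ y‖ ≤ max M₀ 1 := fun τ hτ y =>
    hMb τ ⟨hs.le.trans hτ.1.le, hτ.2.le⟩ y
  have hBc : Continuous (oseenDuhamel ν s u u t) :=
    continuous_oseenDuhamel_slice hν hM.le hum hum hBτ hBτ hst htT₁.le
  have hHc : Continuous (UnboundedOperators.heatExtension (u s) (ν * (t - s))) :=
    (UnboundedOperators.contDiff_heatExtension_of_bound (hcl.contDiff_velocity hsIco).continuous
      (fun z => hMb s ⟨hs.le, hsI.2.le⟩ z) (mul_pos hν (sub_pos.2 hst)) (m := 0)).continuous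
  have huc : Continuous (u t) := (hcl.contDiff_velocity ⟨(hs.trans hst).le, htT⟩).continuous
  have heq := (Continuous.ae_eq_iff_eq volume huc (hHc.sub hBc)).1 hae
  exact congrFun heq x

/-- **Boundedness up to the final time from (L'), unit viscosity** (KNSS 2009, §6: the rescaling
procedure before Prop. 6.1, Lemma 6.1, and the Type-I bookkeeping of the proof of Thm. 6.2). A
classical solution (`ν = 1`) on `ℝ³ × (0, T)`, bounded on every `(0, T') × ℝ³`, `T' < T`,
Oseen-mild between all `0 < s < t < T`, with `√(T − t)‖u(t, x)‖ ≤ C` on `(0, T)`, is bounded on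
`(0, T) × ℝ³` provided every Type-I ancient mild field in the Oseen gauge vanishes (`hX`): otherwise
the zooms at near-maxima are classical Oseen-mild on `(A_k, B_k)`, `A_k → −∞`, `B_k > 0`, bounded
by `2` on `(A_k, 0]`, of norm `1` at `(0, 0)`, with `√(−s)‖w_k(s)‖ ≤ C`; their compactness limit
lies in `IsTypeIAncientMild C` and is killed by `hX`, while the uniform Hölder modulus up to the
final time keeps `‖w_k(−δ, 0)‖ ≥ 1/2`. [cite: KochNadirashviliSereginSverak2009, §6 Prop. 6.1, Lemma 6.1 and proof of Thm 6.2 (arXiv:0709.3599 pp. 11–13)] -/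
theorem liouvilleKillsTypeI_bounded_of_liouville_unit
    (hX : ∀ (C : ℝ) (W : ℝ → EuclideanSpace ℝ (Fin 3) → EuclideanSpace ℝ (Fin 3)),
      IsTypeIAncientMild C W → ∀ t < 0, ∀ x, W t x = 0)
    {T : ℝ} (hT : 0 < T) {u : ℝ → EuclideanSpace ℝ (Fin 3) → EuclideanSpace ℝ (Fin 3)}
    {p : ℝ → EuclideanSpace ℝ (Fin 3) → ℝ}
    (hcl : IsClassicalNSSolutionOn (Ioo 0 T) 1 0 u p)
    (hbdd : ∀ T' < T, ∃ M : ℝ, ∀ t ∈ Ioo 0 T', ∀ x, ‖u t x‖ ≤ M)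
    (hmild : ∀ s t : ℝ, 0 < s → s < t → t < T → ∀ x,
      u t x = UnboundedOperators.heatExtension (u s) (t - s) x - oseenDuhamel 1 s u u t x)
    {C : ℝ} (hC : 0 < C) (hrate : ∀ t ∈ Ioo 0 T, ∀ x, Real.sqrt (T - t) * ‖u t x‖ ≤ C) :
    ∃ M : ℝ, ∀ t ∈ Ioo 0 T, ∀ x, ‖u t x‖ ≤ M := by
  by_contra hunb
  obtain ⟨B₀, hB₀⟩ := hbdd (T / 2) (by linarith)
  have hsel := fun k : ℕ => exists_near_max hbdd hunb ((k : ℝ) + 1 + |B₀|)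
  choose tk htk xk hR hmax using hsel
  obtain ⟨N, hN⟩ : ∃ N : ℕ → ℝ, ∀ k, N k = ‖u (tk k) (xk k)‖ := ⟨_, fun _ => rfl⟩
  simp_rw [← hN] at hR hmax
  have hNge : ∀ k : ℕ, (k : ℝ) + 1 ≤ N k := fun k => by
    have := hR k; linarith [abs_nonneg B₀]
  have hNpos : ∀ k, 0 < N k := fun k => by linarith [hNge k, k.cast_nonneg (α := ℝ)]
  have htk2 : ∀ k, T / 2 ≤ tk k := fun k => by
    by_contra hlt
    push Not at hlt
    have h1 : N k ≤ B₀ := by rw [hN]; exact hB₀ (tk k) ⟨(htk k).1, hlt⟩ (xk k)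
    have h2 : |B₀| < N k := by have := hR k; linarith [k.cast_nonneg (α := ℝ)]
    linarith [le_abs_self B₀]
  set c : ℕ → ℝ := fun k => (N k)⁻¹ with hcdef
  have hcpos : ∀ k, 0 < c k := fun k => inv_pos.2 (hNpos k)
  set A : ℕ → ℝ := fun k => -(tk k / c k ^ 2) with hAdef
  set B : ℕ → ℝ := fun k => (T - tk k) / c k ^ 2 with hBdef
  have hAle : ∀ k : ℕ, A k ≤ -(((k : ℝ) + 1) * (T / 2)) := fun k => by
    have hA' : A k = -(tk k * N k ^ 2) := by
      simp only [hAdef, hcdef, inv_pow, div_inv_eq_mul]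
    rw [hA', neg_le_neg_iff]
    have h1 : ((k : ℝ) + 1) * 1 ≤ N k * N k :=
      mul_le_mul (hNge k) (by linarith [hNge k, k.cast_nonneg (α := ℝ)]) zero_le_one (hNpos k).le
    rw [sq]
    calc ((k : ℝ) + 1) * (T / 2) = T / 2 * (((k : ℝ) + 1) * 1) := by ring
      _ ≤ tk k * (N k * N k) := mul_le_mul (htk2 k) h1 (by positivity) (htk k).1.le
  have hBpos : ∀ k, 0 < B k := fun k => div_pos (by linarith [(htk k).2]) (pow_pos (hcpos k) 2)
  have hAlim : Tendsto A atTop atBot := by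
    refine tendsto_atBot_mono hAle (tendsto_neg_atTop_atBot.comp ?_)
    exact (tendsto_natCast_atTop_atTop.atTop_add tendsto_const_nhds).atTop_mul_const (by positivity)
  set w : ℕ → ℝ → EuclideanSpace ℝ (Fin 3) → EuclideanSpace ℝ (Fin 3) :=
    fun k => c k • stPull (c k ^ 2) (c k) (tk k) (xk k) u with hwdef
  set q : ℕ → ℝ → EuclideanSpace ℝ (Fin 3) → ℝ :=
    fun k => c k ^ 2 • stPull (c k ^ 2) (c k) (tk k) (xk k) p with hqdef
  have hw_apply : ∀ k s y, w k s y = c k • u (tk k + c k ^ 2 * s) (xk k + c k • y) :=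
    fun k s y => rfl
  have hwcl : ∀ k, IsClassicalNSSolutionOn (Ioo (A k) (B k)) 1 0 (w k) (q k) := fun k =>
    (hcl.nsRescale_translate_zero (hcpos k) (tk k) (xk k)).mono
      (fun s hs => zoom_time_mem (hcpos k).ne' hs) (uniqueDiffOn_Ioo _ _)
  have hmem : ∀ k, ∀ s ∈ Ioo (A k) (B k), tk k + c k ^ 2 * s ∈ Ioo 0 T := fun k s hs =>
    zoom_time_mem (hcpos k).ne' hs
  have hwmild : ∀ k, ∀ s t : ℝ, A k < s → s < t → t < B k → ∀ x,
      w k t x = UnboundedOperators.heatExtension (w k s) (t - s) x -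
        oseenDuhamel 1 s (w k) (w k) t x := by
    intro k s t hAs hst htB x
    refine oseen_smul_stPull (hcpos k) (tk k) (xk k) hst (fun X => ?_) x
    have hs' := hmem k s ⟨hAs, hst.trans htB⟩
    have ht' := hmem k t ⟨hAs.trans hst, htB⟩
    have hlt : tk k + c k ^ 2 * s < tk k + c k ^ 2 * t := by
      have := mul_lt_mul_of_pos_left hst (pow_pos (hcpos k) 2)
      linarith
    exact hmild _ _ hs'.1 hlt ht'.2 X
  have hwrate : ∀ k, ∀ τ ∈ Ioo (A k) 0, ∀ x, Real.sqrt (-τ) * ‖w k τ x‖ ≤ C := by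
    intro k τ hτ y
    rw [hw_apply, norm_smul, Real.norm_of_nonneg (hcpos k).le]
    have hτT : tk k + c k ^ 2 * τ ∈ Ioo 0 T := hmem k τ ⟨hτ.1, hτ.2.trans (hBpos k)⟩
    have h1 := hrate _ hτT (xk k + c k • y)
    have hle : c k ^ 2 * (-τ) ≤ T - (tk k + c k ^ 2 * τ) := by nlinarith [(htk k).2]
    have hsq : Real.sqrt (c k ^ 2 * (-τ)) = c k * Real.sqrt (-τ) := by
      rw [Real.sqrt_mul (sq_nonneg _), Real.sqrt_sq (hcpos k).le]
    calc Real.sqrt (-τ) * (c k * ‖u (tk k + c k ^ 2 * τ) (xk k + c k • y)‖)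
        = Real.sqrt (c k ^ 2 * (-τ)) * ‖u (tk k + c k ^ 2 * τ) (xk k + c k • y)‖ := by
          rw [hsq]; ring
      _ ≤ Real.sqrt (T - (tk k + c k ^ 2 * τ)) * ‖u (tk k + c k ^ 2 * τ) (xk k + c k • y)‖ :=
          mul_le_mul_of_nonneg_right (Real.sqrt_le_sqrt hle) (norm_nonneg _)
      _ ≤ C := h1
  have hwbd : ∀ k, ∀ s ∈ Ioc (A k) 0, ∀ y, ‖w k s y‖ ≤ 2 := by
    intro k s hs y
    rw [hw_apply, norm_smul, Real.norm_of_nonneg (hcpos k).le]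
    have hsm := zoom_time_mem_Ioc (hcpos k).ne' hs
    have h1 := hmax k _ hsm (xk k + c k • y)
    calc c k * ‖u (tk k + c k ^ 2 * s) (xk k + c k • y)‖ ≤ c k * (2 * N k) :=
          mul_le_mul_of_nonneg_left h1 (hcpos k).le
      _ = 2 := by
          simp only [hcdef]
          rw [mul_comm 2 (N k), inv_mul_cancel_left₀ (hNpos k).ne']
  have hw0 : ∀ k, ‖w k 0 0‖ = 1 := fun k => by
    rw [hw_apply, mul_zero, add_zero, smul_zero, add_zero, norm_smul,
      Real.norm_of_nonneg (hcpos k).le, ← hN k]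
    simp only [hcdef]
    exact inv_mul_cancel₀ (hNpos k).ne'
  -- ## compactness (KNSS Lemma 6.1 in the Type-I-rate Oseen-mild class)
  obtain ⟨φ, W, hφ, hWc, hWdiv, hWrate, hWmild, hWlim⟩ :=
    typeIZoom_compactness C A B w q hC hAlim hBpos hwcl hwmild hwrate
  have hWI : HasTypeITimeDecay C W := fun t ht x => by
    rw [le_div_iff₀ (Real.sqrt_pos.2 (neg_pos.2 ht)), mul_comm]
    exact hWrate t ht x
  have hWA : IsTypeIAncientMild C W :=
    isTypeIAncientMild_of_continuous_oseenMild hWc hWdiv hWmild hWI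
  have hW0 : ∀ t < 0, ∀ x, W t x = 0 := hX C W hWA
  -- ## the vertex: uniform Hölder modulus up to the final time
  obtain ⟨K₀, hK₀, hHold⟩ := exists_holder_quarter_of_oseenMild (E := EuclideanSpace ℝ (Fin 3))
  set d : ℝ := 1 / (12 * (K₀ + 1)) with hddef
  have hdpos : 0 < d := by rw [hddef]; positivity
  have hdle : d ≤ 1 := by
    rw [hddef, div_le_one (by positivity)]; nlinarith
  set δ : ℝ := d ^ 4 with hδdef
  have hδpos : 0 < δ := pow_pos hdpos 4
  have hδle : δ ≤ 1 := pow_le_one₀ hdpos.le hdle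
  have hδroot : δ ^ (1 / 4 : ℝ) = d := by
    rw [hδdef, show (1 / 4 : ℝ) = ((4 : ℕ) : ℝ)⁻¹ by norm_num]
    exact Real.pow_rpow_inv_natCast hdpos.le (by norm_num)
  have h6 : (2 : ℝ) + 2 ^ 2 = 6 := by norm_num
  have hsmall : K₀ * (2 + 2 ^ 2) * δ ^ (1 / 4 : ℝ) < 1 / 2 := by
    rw [hδroot, h6, hddef, mul_one_div, div_lt_iff₀ (by positivity)]
    nlinarith
  have hφt : Tendsto φ atTop atTop := hφ.tendsto_atTop
  have hbig : ∀ᶠ j in atTop, A (φ j) < -2 := (hAlim.comp hφt).eventually (eventually_lt_atBot _)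
  have hfar : ∀ᶠ j in atTop, (1 / 2 : ℝ) ≤ ‖w (φ j) (-δ) 0‖ := by
    filter_upwards [hbig] with j hj
    have hIcc : ∀ t ∈ Icc (-2 : ℝ) 0, t ∈ Ioo (A (φ j)) (B (φ j)) := fun t ht =>
      ⟨hj.trans_le ht.1, ht.2.trans_lt (hBpos (φ j))⟩
    have hmod := hHold (u := w (φ j)) (a := -2) (b := 0) (m := 2) zero_le_two
      (fun t ht => ((hwcl (φ j)).contDiff_velocity (hIcc t ht)).continuous)
      (fun t ht y => hwbd (φ j) t ⟨hj.trans_le ht.1, ht.2⟩ y)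
      (fun s t has hst htb y => hwmild (φ j) s t (hj.trans_le has) hst
        (htb.trans_lt (hBpos (φ j))) y)
      0 ⟨by norm_num, le_rfl⟩ (-δ) ⟨by linarith, by linarith⟩ 0 0
    rw [show max |(-δ) - 0| ‖(0 : EuclideanSpace ℝ (Fin 3)) - 0‖ = δ by
      simp [abs_of_pos hδpos, hδpos.le]] at hmod
    have h1 : ‖w (φ j) (-δ) 0 - w (φ j) 0 0‖ < 1 / 2 := lt_of_le_of_lt hmod hsmall
    have h2 := norm_sub_norm_le (w (φ j) 0 0) (w (φ j) (-δ) 0)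
    rw [norm_sub_rev, hw0 (φ j)] at h2
    linarith
  have hδneg : -δ < 0 := neg_neg_of_pos hδpos
  have hlim : Tendsto (fun j => w (φ j) (-δ) 0) atTop (𝓝 (W (-δ) 0)) :=
    ((hWlim (-δ) hδneg).tendstoLocallyUniformlyOn (s := univ)).tendsto_at
      (mem_univ (0 : EuclideanSpace ℝ (Fin 3)))
  rw [hW0 (-δ) hδneg 0] at hlim
  have hn : Tendsto (fun j => ‖w (φ j) (-δ) 0‖) atTop (𝓝 0) := by
    simpa using hlim.norm
  have hnear : ∀ᶠ j in atTop, ‖w (φ j) (-δ) 0‖ < 1 / 2 :=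
    hn.eventually (eventually_lt_nhds (by norm_num : (0 : ℝ) < 1 / 2))
  obtain ⟨j, hj1, hj2⟩ := (hfar.and hnear).exists
  linarith

open Summit.NavierStokesRegularity.NavierStokesRegularity.Theses.SymmetryModuliCount in
/-- **`LiouvilleKillsTypeI` (route `SymmetryModuliCount`, item stmt-NavierStokesRegularity-4056).**
If every smooth divergence-free KNSS-mild ancient field on `(−∞, 0) × ℝ³` with the Type-I temporal
bound vanishes, then every classical solution of Navier–Stokes (`ν > 0`) on `ℝ³ × [0, T)`,
Leray–Hopf from its rapidly decaying datum and blowing up at most at the Type-I rate at `T`,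
extends smoothly past `T`: Steps 1–3 for the viscosity-normalised field `ν⁻¹u(s/ν, x)`, then the
continuation of bounded classical Leray–Hopf solutions. [cite: KochNadirashviliSereginSverak2009, §6 Prop. 6.1 and Lemma 6.1 (arXiv:0709.3599 p. 11)] -/
theorem symmetryModuliCount_liouvilleKillsTypeI_proof : LiouvilleKillsTypeI := by
  intro hX ν T hν hT u p hcl hLH hdec hTI
  have hX' : ∀ (C : ℝ) (W : ℝ → EuclideanSpace ℝ (Fin 3) → EuclideanSpace ℝ (Fin 3)),
      IsTypeIAncientMild C W → ∀ t < 0, ∀ x, W t x = 0 :=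
    fun C W hW => hX C W (isTypeIAncientMild_iff.1 hW)
  apply hasSmoothExtensionPast_of_bounded_holds hν hT hcl hLH
  -- Step 1: bounds on the closed sub-slabs, and the rate on the whole interval
  have hbddIcc : ∀ T' ∈ Ioo 0 T, ∃ M : ℝ, ∀ t ∈ Icc 0 T', ∀ x, ‖u t x‖ ≤ M := fun T' hT' =>
    liouvilleKillsTypeI_exists_bound_Icc hν hcl hLH hdec hT'
  have hbdd' : ∀ T' < T, ∃ M : ℝ, ∀ t ∈ Icc 0 T', ∀ x, ‖u t x‖ ≤ M := by
    intro T' hT'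
    by_cases h : 0 < T'
    · exact hbddIcc T' ⟨h, hT'⟩
    · obtain ⟨M, hM⟩ := hbddIcc (T / 2) ⟨by linarith, by linarith⟩
      push Not at h
      exact ⟨M, fun t ht x => hM t ⟨ht.1, by linarith [ht.2]⟩ x⟩
  obtain ⟨C₀, hC₀⟩ := hTI.exists_sqrt_mul_norm_le hbdd'
  -- Step 2: the Oseen integral equation with viscosity `ν`
  have hos : ∀ s t : ℝ, 0 < s → s < t → t < T → ∀ x,
      u t x = UnboundedOperators.heatExtension (u s) (ν * (t - s)) x - oseenDuhamel ν s u u t x :=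
    fun s t hs hst htT x => liouvilleKillsTypeI_oseen_identity hν hT hcl hLH hbddIcc hs hst htT x
  -- the viscosity normalisation `v(s, x) = ν⁻¹ u(s/ν, x)` on `(0, νT)`
  have hνT : 0 < ν * T := mul_pos hν hT
  set v : ℝ → EuclideanSpace ℝ (Fin 3) → EuclideanSpace ℝ (Fin 3) := timeRescale ν⁻¹ ν⁻¹ u
    with hvdef
  have hv_apply : ∀ s x, v s x = ν⁻¹ • u (ν⁻¹ * s) x := fun s x => rfl
  have hmaps : MapsTo (fun s => ν⁻¹ * s) (Ioo 0 (ν * T)) (Ico 0 T) := fun s hs =>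
    Ioo_subset_Ico_self ((inv_mul_mem_Ioo_iff hν).2 hs)
  have hvcl : IsClassicalNSSolutionOn (Ioo 0 (ν * T)) 1 0 v (timeRescale ν⁻¹ (ν⁻¹ ^ 2) p) := by
    simpa using hcl.viscosityRescale_set hν.ne' hmaps isOpen_Ioo.uniqueDiffOn
  have hvbdd : ∀ T' < ν * T, ∃ M : ℝ, ∀ s ∈ Ioo 0 T', ∀ x, ‖v s x‖ ≤ M := by
    intro T' hT'
    by_cases h : 0 < T'
    · have hT'ν : T' / ν ∈ Ioo 0 T := ⟨div_pos h hν, by rwa [div_lt_iff₀ hν, mul_comm]⟩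
      obtain ⟨M, hM⟩ := hbddIcc (T' / ν) hT'ν
      refine ⟨ν⁻¹ * M, fun s hs x => ?_⟩
      rw [hv_apply, norm_smul, norm_inv, Real.norm_of_nonneg hν.le]
      refine mul_le_mul_of_nonneg_left (hM _ ⟨?_, ?_⟩ x) (inv_nonneg.2 hν.le)
      · exact mul_nonneg (inv_nonneg.2 hν.le) hs.1.le
      · rw [div_eq_inv_mul]
        exact mul_le_mul_of_nonneg_left hs.2.le (inv_nonneg.2 hν.le)
    · push Not at h
      exact ⟨0, fun s hs x => absurd (hs.1.trans hs.2) (not_lt.2 h)⟩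
  have hvmild : ∀ σ₁ σ₂ : ℝ, 0 < σ₁ → σ₁ < σ₂ → σ₂ < ν * T → ∀ x,
      v σ₂ x = UnboundedOperators.heatExtension (v σ₁) (σ₂ - σ₁) x -
        oseenDuhamel 1 σ₁ v v σ₂ x := by
    intro σ₁ σ₂ h1 h12 h2 x
    obtain ⟨s, rfl⟩ : ∃ s, σ₁ = ν * s := ⟨ν⁻¹ * σ₁, (mul_inv_cancel_left₀ hν.ne' σ₁).symm⟩
    obtain ⟨t, rfl⟩ : ∃ t, σ₂ = ν * t := ⟨ν⁻¹ * σ₂, (mul_inv_cancel_left₀ hν.ne' σ₂).symm⟩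
    have hs : 0 < s := pos_of_mul_pos_right h1 hν.le
    have hst : s < t := lt_of_mul_lt_mul_left h12 hν.le
    have htT : t < T := lt_of_mul_lt_mul_left h2 hν.le
    rw [hvdef, oseenDuhamel_one_timeRescale hν u hst.le x, timeRescale_apply, timeRescale_slice,
      UnboundedOperators.heatExtension_const_smul, inv_mul_cancel_left₀ hν.ne' t,
      inv_mul_cancel_left₀ hν.ne' s, show ν * t - ν * s = ν * (t - s) by ring,
      hos s t hs hst htT x, smul_sub]
  have hC : (0 : ℝ) < max (Real.sqrt ν * ν⁻¹ * C₀) 1 := lt_of_lt_of_le one_pos (le_max_right _ _)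
  have hvrate : ∀ σ ∈ Ioo 0 (ν * T), ∀ x,
      Real.sqrt (ν * T - σ) * ‖v σ x‖ ≤ max (Real.sqrt ν * ν⁻¹ * C₀) 1 := by
    intro σ hσ x
    obtain ⟨t, rfl⟩ : ∃ t, σ = ν * t := ⟨ν⁻¹ * σ, (mul_inv_cancel_left₀ hν.ne' σ).symm⟩
    have ht0 : 0 < t := pos_of_mul_pos_right hσ.1 hν.le
    have htT : t < T := lt_of_mul_lt_mul_left hσ.2 hν.le
    rw [hv_apply, inv_mul_cancel_left₀ hν.ne' t, show ν * T - ν * t = ν * (T - t) by ring,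
      Real.sqrt_mul hν.le, norm_smul, norm_inv, Real.norm_of_nonneg hν.le]
    have h1 := hC₀ t ⟨ht0.le, htT⟩ x
    calc Real.sqrt ν * Real.sqrt (T - t) * (ν⁻¹ * ‖u t x‖)
        = Real.sqrt ν * ν⁻¹ * (Real.sqrt (T - t) * ‖u t x‖) := by ring
      _ ≤ Real.sqrt ν * ν⁻¹ * C₀ := mul_le_mul_of_nonneg_left h1 (by positivity)
      _ ≤ max (Real.sqrt ν * ν⁻¹ * C₀) 1 := le_max_left _ _
  obtain ⟨M, hM⟩ :=
    liouvilleKillsTypeI_bounded_of_liouville_unit hX' hνT hvcl hvbdd hvmild hC hvrate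
  obtain ⟨M₀, hM₀⟩ := hbddIcc (T / 2) ⟨by linarith, by linarith⟩
  refine ⟨max (ν * M) M₀, fun t ht x => ?_⟩
  rcases ht.1.eq_or_lt with h0 | h0
  · rw [← h0]
    exact (hM₀ 0 ⟨le_rfl, by linarith⟩ x).trans (le_max_right _ _)
  · have h1 := hM (ν * t) ⟨mul_pos hν h0, mul_lt_mul_of_pos_left ht.2 hν⟩ x
    rw [hv_apply, inv_mul_cancel_left₀ hν.ne' t, norm_smul, norm_inv, Real.norm_of_nonneg hν.le,
      inv_mul_le_iff₀ hν] at h1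
    exact h1.trans (le_max_left _ _)

end Summit.NavierStokesRegularity.NavierStokesRegularity.Theorems

end
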